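import Literature.AlgebraicGeometry.Resolution.KnafKuhlmann2009Assembly
import Literature.AlgebraicGeometry.Resolution.NormalizationFractions
import HarnessLib

/-!
# Pulling an ambient smooth uniformization back to the function field (`stub_pullback`)

Stub of the birth line of the crux `ShadowsUniformize` (route `AbhyankarShadows`), discrete
branch (relative local uniformization at a discrete rational place, Knaf–Kuhlmann 2009,
Thm. 1.5).

Setting: `k ⊆ K` fields, `O ⊇ k` a valuation subring of `K`, `R ⊆ O` a finitely generated
`k`-subalgebra; an ambient field `Ω ⊇ K` (compatibly a `k`-algebra) with a valuation subring
`V` extending `O` (`V ∩ K = O`, i.e. `V.comap (algebraMap K Ω) = O`). Write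
`k' := (algebraMap k Ω).fieldRange ≤ K' := (algebraMap K Ω).fieldRange` for the copies of `k`
and `K` inside `Ω`.

Hypothesis (the output of the analytic part of the line): every finite `Z ⊆ V ∩ K'` is
smoothly `k'`-uniformizable in the ambient rendering (`IsSmoothlyUniformizableIn k' V K' Z`,
Knaf–Kuhlmann 2009 §1 / §3.1: an affine model `A ⊆ V ∩ K'`, finitely presented over `k'`,
`Frac A = K'`, smooth over `k'` at the centre of `V`, with `Z` inside the local ring at the
centre).

Claim: there is a finitely generated `k`-subalgebra `A ⊆ O` of `K` containing `R`, with
`Frac A = K`, whose localization at the centre `𝔪_O ∩ A` is a regular local ring.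

Proof: take for `Z` the image in `Ω` of a finite generating set of `R`; improve the model given
by the hypothesis to an everywhere formally smooth finitely generated `B ⊆ V ∩ K'` containing
`Z` with `Frac B = K'` (`exists_smooth_model`); `B` is finitely presented over the field `k'`,
so its local ring at the (prime) centre of `V` is regular (`isRegularLocalRing_of_isSmoothAt`,
EGA IV 17.5.8 (iii) over a field). Finally pull `B` back along the injection `K → Ω`: the
preimage `A` is a finitely generated `k`-subalgebra of `K` inside `O` (as `V ∩ K = O`)
containing the generators of `R`, every element of `K` is a quotient of elements of `A`, and
`A ≃ B` carries the centre of `O` to the centre of `V`, so the two local rings are isomorphic.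
-/

-- single-problem summit: the doubled namespace component is forced
set_option linter.dupNamespace false

open Literature.AlgebraicGeometry.Resolution

namespace Summit.ResolutionOfSingularities.ResolutionOfSingularities.Theorems

/-- A ring isomorphism carrying the prime `p₁` onto the prime `p₂` (`p₁ = e⁻¹(p₂)`) maps the
complement of `p₁` onto the complement of `p₂`. [folklore] -/
theorem primeCompl_map_ringEquiv_of_comap_eq {A₁ A₂ : Type*} [CommRing A₁] [CommRing A₂]
    (e : A₁ ≃+* A₂) (p₁ : Ideal A₁) (p₂ : Ideal A₂) [p₁.IsPrime] [p₂.IsPrime]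
    (hp : p₁ = p₂.comap e.toRingHom) :
    p₁.primeCompl.map e.toRingHom.toMonoidHom = p₂.primeCompl := by
  ext y
  constructor
  · rintro ⟨x, hx, rfl⟩
    intro hy
    exact hx (by rw [hp]; exact hy)
  · intro hy
    refine ⟨e.symm y, fun hx => hy ?_, e.apply_symm_apply y⟩
    rw [hp] at hx
    simpa using hx

/-- **Pull-back of an ambient smooth uniformization** (Knaf–Kuhlmann 2009, §3.1, affine models;
Thm. 1.5 read back in the function field): if `V ∩ K = O` for a valuation subring `V` of an
ambient field `Ω ⊇ K ⊇ k` and every finite subset of `V ∩ K'` (`K'` the copy of `K` in `Ω`) is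
smoothly `k'`-uniformizable (`k'` the copy of `k`), then every finitely generated `R ⊆ O` is
dominated by a finitely generated `A ⊆ O` with `Frac A = K` whose local ring at the centre of
`O` is regular. [cite: KnafKuhlmann2009, Section 3.1 (p. 14)] -/
theorem stub_pullback (k K Ω : Type) [Field k] [Field K] [Algebra k K] [Field Ω] [Algebra K Ω]
    [Algebra k Ω] [IsScalarTower k K Ω] (O : ValuationSubring K) (V : ValuationSubring Ω)
    (hV : V.comap (algebraMap K Ω) = O) (hk : ∀ c : k, algebraMap k K c ∈ O)
    (R : Subalgebra k K) (hR : R.FG) (hRO : R.toSubring ≤ O.toSubring)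
    (hSU : ∀ Z : Finset Ω, (∀ z ∈ Z, z ∈ V ∧ z ∈ (algebraMap K Ω).fieldRange) →
      IsSmoothlyUniformizableIn (algebraMap k Ω).fieldRange V (algebraMap K Ω).fieldRange
        (Z : Set Ω)) :
    ∃ (A : Subalgebra k K) (h : A.toSubring ≤ O.toSubring), R ≤ A ∧ A.FG ∧
      IsFractionRing A K ∧ IsRegularLocalRing
        (Localization.AtPrime (Ideal.comap (Subring.inclusion h) (IsLocalRing.maximalIdeal O))) := by
  classical
  have _hk := hk
  let ι : K →+* Ω := algebraMap K Ω
  let ιa : K →ₐ[k] Ω := IsScalarTower.toAlgHom k K Ω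
  have hιa : ∀ z, ιa z = ι z := fun _ => rfl
  set kΩ : Subfield Ω := (algebraMap k Ω).fieldRange with hkΩ
  set KΩ : Subfield Ω := (algebraMap K Ω).fieldRange with hKΩ
  have hmemV : ∀ z : K, ι z ∈ V ↔ z ∈ O := fun z => by
    rw [← ValuationSubring.mem_comap, hV]
  have hvlt : ∀ z : K, O.valuation z < 1 ↔ V.valuation (ι z) < 1 := fun z => by
    rw [← hV]
    exact comap_valuation_lt_one_iff V ι z
  have hmemKΩ : ∀ z : K, ι z ∈ KΩ := fun z => RingHom.mem_fieldRange.mpr ⟨z, rfl⟩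
  -- the finite set `Z`: the image of a generating set of `R`
  obtain ⟨t, ht⟩ := hR
  have htR : (t : Set K) ⊆ R := ht ▸ Algebra.subset_adjoin
  have htΩ : ∀ s ∈ t.image ι, s ∈ V ∧ s ∈ KΩ := by
    intro s hs
    obtain ⟨z, hz, rfl⟩ := Finset.mem_image.mp hs
    exact ⟨(hmemV z).mpr (hRO (htR hz)), hmemKΩ z⟩
  -- an everywhere smooth model in `Ω` containing `Z`
  obtain ⟨A, hAV, hAK, hAfg, hAsm, htA, hfrac⟩ := exists_smooth_model (hSU (t.image ι) htΩ)
  haveI := hAsm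
  haveI : Algebra.FiniteType kΩ A := (Subalgebra.fg_iff_finiteType A).mp hAfg
  haveI : Algebra.FinitePresentation kΩ A :=
    Algebra.FinitePresentation.of_finiteType.mp inferInstance
  haveI : Algebra.IsSmoothAt kΩ (centre A V hAV) := isSmoothAt_of_formallySmooth _
  have hreg : IsRegularLocalRing (Localization.AtPrime (centre A V hAV)) :=
    isRegularLocalRing_of_isSmoothAt kΩ A (centre A V hAV)
  -- pulled back to `K`
  let B : Subalgebra k K :=
    { A.toSubring.comap ι with
      algebraMap_mem' := fun c => by
        change ι (algebraMap k K c) ∈ A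
        exact A.algebraMap_mem
          ⟨ι (algebraMap k K c), RingHom.mem_fieldRange.mpr
            ⟨c, IsScalarTower.algebraMap_apply k K Ω c⟩⟩ }
  have hmemB : ∀ z : K, z ∈ B ↔ ι z ∈ A := fun z => Iff.rfl
  have hAι : ∀ w ∈ A, ∃ z : K, ι z = w := fun w hw =>
    RingHom.mem_fieldRange.mp (hAK hw)
  have hBO : B.toSubring ≤ O.toSubring := fun z hz => (hmemV z).mp (hAV ((hmemB z).mp hz))
  refine ⟨B, hBO, ?_, ?_, ?_, ?_⟩
  · -- `R ≤ B`
    rw [← ht]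
    refine Algebra.adjoin_le fun z hz => (hmemB z).mpr (htA ?_)
    exact Finset.mem_coe.mpr (Finset.mem_image.mpr ⟨z, hz, rfl⟩)
  · -- `B` is finitely generated
    obtain ⟨t₂, ht₂⟩ := hAfg
    have ht₂A : (t₂ : Set Ω) ⊆ A := ht₂ ▸ Algebra.subset_adjoin
    have hinj : Set.InjOn ι (ι ⁻¹' (t₂ : Set Ω)) := fun a _ b _ h => ι.injective h
    let t₃ : Finset K := t₂.preimage ι hinj
    have ht₃ : ι '' (t₃ : Set K) = t₂ := by
      rw [Finset.coe_preimage]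
      refine Set.image_preimage_eq_of_subset fun w hw => ?_
      obtain ⟨z, hz⟩ := hAι w (ht₂A hw)
      exact ⟨z, hz⟩
    refine ⟨t₃, le_antisymm (Algebra.adjoin_le fun z hz => ?_) fun z hz => ?_⟩
    · rw [Finset.mem_coe, Finset.mem_preimage] at hz
      exact (hmemB z).mpr (ht₂A hz)
    · -- `ι z ∈ k[t₂] = ι(k[t₃])`
      let T : Subalgebra kΩ Ω :=
        { (Algebra.adjoin k (t₂ : Set Ω)).toSubring.toSubsemiring with
          algebraMap_mem' := fun c => by
            obtain ⟨c', hc'⟩ := RingHom.mem_fieldRange.mp c.2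
            change (c : Ω) ∈ Algebra.adjoin k (t₂ : Set Ω)
            rw [← hc']
            exact (Algebra.adjoin k (t₂ : Set Ω)).algebraMap_mem c' }
      have hAT : A ≤ T := by
        rw [← ht₂]
        exact Algebra.adjoin_le fun w hw => (Algebra.subset_adjoin hw : w ∈ Algebra.adjoin k _)
      have h1 : ι z ∈ Algebra.adjoin k (t₂ : Set Ω) := hAT ((hmemB z).mp hz)
      have himg : (ιa : K → Ω) '' (t₃ : Set K) = (t₂ : Set Ω) := by rw [← ht₃]; rfl
      have h2 : (Algebra.adjoin k (t₃ : Set K)).map ιa = Algebra.adjoin k (t₂ : Set Ω) := by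
        rw [AlgHom.map_adjoin, himg]
      rw [← h2, Subalgebra.mem_map] at h1
      obtain ⟨z', hz', hzz'⟩ := h1
      rw [hιa] at hzz'
      rwa [← ι.injective hzz']
  · -- `Frac B = K`
    refine isFractionRing_of_forall_exists_div B.toSubring fun z => ?_
    obtain ⟨a', ha', b', hb', hab⟩ := hfrac (ι z) (hmemKΩ z)
    obtain ⟨a, rfl⟩ := hAι a' ha'
    obtain ⟨b, rfl⟩ := hAι b' hb'
    refine ⟨a, (hmemB a).mpr ha', b, (hmemB b).mpr hb', ι.injective ?_⟩
    rw [hab, map_div₀]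
  · -- regular at the centre, transported along `B ≃ A`
    let e₀ : B →+* A :=
      { toFun := fun z => ⟨ι (z : K), (hmemB z).mp z.2⟩
        map_one' := Subtype.ext (map_one ι)
        map_mul' := fun a b => Subtype.ext (map_mul ι (a : K) (b : K))
        map_zero' := Subtype.ext (map_zero ι)
        map_add' := fun a b => Subtype.ext (map_add ι (a : K) (b : K)) }
    have he₀ : Function.Bijective e₀ := by
      refine ⟨fun a b h => Subtype.ext (ι.injective (congrArg Subtype.val h)), fun w => ?_⟩
      obtain ⟨z, hz⟩ := hAι w w.2
      exact ⟨⟨z, (hmemB z).mpr (hz ▸ w.2)⟩, Subtype.ext hz⟩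
    let e : B ≃+* A := RingEquiv.ofBijective e₀ he₀
    have he : ∀ z : B, ((e z : A) : Ω) = ι z := fun _ => rfl
    change IsRegularLocalRing (Localization.AtPrime (centre B O hBO))
    have hPQ : centre B O hBO = (centre A V hAV).comap e.toRingHom := by
      ext z
      rw [Ideal.mem_comap, mem_centre_iff, mem_centre_iff]
      change O.valuation (z : K) < 1 ↔ V.valuation ((e z : A) : Ω) < 1
      rw [he]
      exact hvlt z
    have hmap := primeCompl_map_ringEquiv_of_comap_eq e (centre B O hBO) (centre A V hAV) hPQ
    let eL : Localization.AtPrime (centre B O hBO) ≃+* Localization.AtPrime (centre A V hAV) :=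
      IsLocalization.ringEquivOfRingEquiv (Localization.AtPrime (centre B O hBO))
        (Localization.AtPrime (centre A V hAV)) e hmap
    exact @IsRegularLocalRing.of_ringEquiv (Localization.AtPrime (centre A V hAV)) _ hreg
      (Localization.AtPrime (centre B O hBO)) _ eL.symm

end Summit.ResolutionOfSingularities.ResolutionOfSingularities.Theorems
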